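import Summits.Ventures.CertifiedArithmetic.Expansions.CompressTieFreeStair
import Mathlib.Tactic.Linarith
import Mathlib.Tactic.Positivity
import Mathlib.Tactic.Ring
import Mathlib.Tactic.NormNum

/-!
# COMPRESS off the ties, II: the upward sweep is the identity and the output is fixed by every
# round-to-nearest (new work)

New work of the certified-arithmetic venture (ENGINES group: shared numerical engines serving
client cells; rigour lives in the verifiers; every published number belongs to a client cell's
ledger, not to the engines group).  Sequel of `CompressTieFreeStair.lean` (the definitions
`TieFree`, `DownTieFree`, `UpTieFree`, `CompressTieFree`, `SAbsorbs`, `StrictlyAbsorbed` and the strict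
stair of a tie-free downward sweep are there); setting of `Shewchuk1997.Compress` [Shewchuk1997,
§2.7 p. 332, Theorem 23].  NOT a published theorem: Shewchuk says nothing about iterating COMPRESS.

For every nonoverlapping expansion `e` of floats and every precision `p ≥ 2`, IF COMPRESS RUNS
TIE-FREE on `e` (no FAST-TWO-SUM of either traversal rounds a midpoint):

* `compressUp_eq_cons_of_tieFree` — on a strict stair `Q :: gs` (smallest first) a tie-free upward
  sweep (Lines 10–16) changes NOTHING: each FAST-TWO-SUM(g, Q) returns `(g, Q)` because
  `|Q| < ½ulp(g + Q)` — the boundary case `2|Q| = ulp(g + Q)` would be a tie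
  (`abs_lt_half_ulp_of_tieFree`: `g` and every float within half an ulp of `g + Q` are multiples of
  `ulp(g + Q)`, so a half-multiple is at distance `≥ ½ulp` from all of them) — hence
  `compressUp fl Q gs = Q :: gs`, consecutive components being `StrictlyAbsorbed`
  (`a ≠ 0`, floats, `|a| < ½ulp(b + a)`);
* `compress_eq_of_tieFree` — so COMPRESS(e) is `g_bottom` followed by the components emitted by
  the downward sweep, smallest first (the upward sweep re-emits everything), and
  `compress_isChain_of_tieFree` — its consecutive components are `StrictlyAbsorbed`, i.e. each is
  absorbed by the next under EVERY round-to-nearest [BoldoEtAl2023, §2.6 Property 2.7];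
* `compress_compress_of_tieFree` — therefore `COMPRESS'(COMPRESS(e)) = COMPRESS(e)` for COMPRESS'
  run with ANY round-to-nearest `fl'` (any tie rule), by the replay lemma
  `compress_eq_self_of_isChain`; in particular `compress_idempotent_of_tieFree`
  (`fl' = fl`), and contrapositively `not_compressTieFree_of_compress_compress_ne`: if a second
  pass of COMPRESS changes anything, the first pass met a tie.

So the growth of the number of passes with the length of the input (`CompressThreePasses.lean`
and longer examples) lives entirely on the measure-zero set of inputs meeting a rounding tie; under a
directed "random" perturbation of the data COMPRESS∘COMPRESS = COMPRESS.  EVIDENCE BEFORE THE PROOF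
(integer model of COMPRESS, not part of the formal content): 164 857 random and 45 968 exhaustively
enumerated tie-free runs (`p = 2…5`, up to 9 components; ties-to-even / ties-away / to-zero / to-odd
variants for the second pass): the upward sweep returned the downward list in every run and no
second pass changed the result; conversely every recorded multi-pass input meets a tie in pass one.
-/

namespace Summit.Ventures.CertifiedArithmetic.Expansions

open Literature.ComputerArithmetic.JeannerodRump2018
open Literature.ComputerArithmetic.BoldoJeannerodMelquiondMuller2023 hiding twoSum twoSum_fst
open Literature.ComputerArithmetic.Shewchuk1997

variable {p : ℕ} {emin : ℤ} {fl : ℚ → ℚ}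

/-! ### The tie exclusion -/

/-- THE TIE EXCLUSION: let the float `b` and `a` satisfy `2|a| ≤ ulp(b)` and `2|a| ≤ ulp(b + a)`.
If `b + a` is rounded without a tie then `|a| < ½ulp(b + a)`: equality would put `b + a` midway
between two consecutive multiples of `ulp(b + a)`, at distance `≥ ½ulp(b + a)` from every float within
half an ulp of it. [cite: BoldoEtAl2023, §2.6 Property 2.7 (proof)] -/
theorem abs_lt_half_ulp_of_tieFree (hp : 1 ≤ p) (hfl : IsRoundNearest p emin fl) {a b : ℚ}
    (hb : IsFloat p emin b) (h1 : 2 * |a| ≤ ulp p emin b) (h2 : 2 * |a| ≤ ulp p emin (b + a))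
    (htf : TieFree p emin fl (b + a)) : |a| < ulp p emin (b + a) / 2 := by
  refine lt_of_le_of_ne (by linarith) fun heq => ?_
  set U := ulp p emin (b + a) with hU
  have hUpos : 0 < U := ulp_pos _
  obtain ⟨K, hK⟩ := exists_eq_int_mul_ulp_add hb h1
  have htf' : |b + a - fl (b + a)| < U / 2 := htf
  obtain ⟨K', hK'⟩ := exists_eq_int_mul_ulp_of_abs_sub_lt hp (hfl (b + a)).1 htf'
  rw [← hU] at hK hK'
  have key : U / 2 ≤ |b + a - fl (b + a)| := by
    rw [hK', hK]
    rcases (abs_eq (by positivity : (0 : ℚ) ≤ U / 2)).mp heq with ha | ha <;> rw [ha]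
    · rcases le_or_gt K' K with hle | hlt
      · have h : (K' : ℚ) * U ≤ K * U := mul_le_mul_of_nonneg_right (by exact_mod_cast hle) hUpos.le
        rw [abs_of_nonneg (by linarith)]; linarith
      · have h : ((K : ℚ) + 1) * U ≤ K' * U :=
          mul_le_mul_of_nonneg_right (by exact_mod_cast hlt) hUpos.le
        rw [abs_of_nonpos (by linarith)]; linarith
    · rcases lt_or_ge K' K with hlt | hle
      · have h : ((K' : ℚ) + 1) * U ≤ K * U :=
          mul_le_mul_of_nonneg_right (by exact_mod_cast hlt) hUpos.le
        rw [abs_of_nonneg (by linarith)]; linarith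
      · have h : (K : ℚ) * U ≤ K' * U := mul_le_mul_of_nonneg_right (by exact_mod_cast hle) hUpos.le
        rw [abs_of_nonpos (by linarith)]; linarith
  linarith

/-! ### Lines 10–16 off the ties: nothing happens -/

/-- **Lines 10–16 off the ties.**  On a strict stair (`Q :: gs`, smallest first) an upward sweep
that runs tie-free returns `Q :: gs` itself — every FAST-TWO-SUM(g, Q) is `(g, Q)` — and consecutive
components are `StrictlyAbsorbed`. [cite: Shewchuk1997, §2.7 p. 332 (COMPRESS), Lines 10–16] -/
theorem compressUp_eq_cons_of_tieFree (hp : 1 ≤ p) (hfl : IsRoundNearest p emin fl) :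
    ∀ (gs : List ℚ) (Q : ℚ), IsFloat p emin Q → (∀ g ∈ gs, IsFloat p emin g) →
      (Q :: gs).IsChain (fun a b => SAbsorbs p emin b a) → UpTieFree p emin fl Q gs →
      compressUp fl Q gs = Q :: gs ∧ (Q :: gs).IsChain (StrictlyAbsorbed p emin)
  | [], Q, _, _, _, _ => by simp
  | g :: gs, Q, hQ, hF, hch, htf => by
    obtain ⟨⟨hQ0, h1, h2⟩, hrest⟩ := List.isChain_cons_cons.mp hch
    have hg : IsFloat p emin g := hF g (by simp)
    have hlt : |Q| < ulp p emin (g + Q) / 2 := abs_lt_half_ulp_of_tieFree hp hfl hg h1 h2 htf.1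
    have hgQ : fl (g + Q) = g :=
      fl_eq_of_abs_sub_lt_half_ulp hp hfl hg (by rwa [add_sub_cancel_left])
    have hfts : fastTwoSum fl g Q = (g, Q) := by
      simp [fastTwoSum, hgQ, fl_zero hfl, fl_eq_self hfl hQ]
    have htf' : UpTieFree p emin fl g gs := by simpa [hfts] using htf.2
    obtain ⟨ih1, ih2⟩ := compressUp_eq_cons_of_tieFree hp hfl gs g hg
      (fun x hx => hF x (List.mem_cons_of_mem _ hx)) hrest htf'
    refine ⟨?_, List.isChain_cons_cons.mpr ⟨⟨hQ0, hQ, hg, hlt⟩, ih2⟩⟩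
    rw [compressUp_cons_of_ne_zero (by rw [hfts]; exact hQ0), hfts]
    dsimp only
    rw [ih1]

/-! ### COMPRESS off the ties -/

/-- **COMPRESS off the ties, the shape of the output**: if COMPRESS runs tie-free on a nonoverlapping
expansion `e` of floats (`e.reverse = eₘ :: rest`), its output is `g_bottom` followed by the
components emitted by the downward sweep, smallest first — the upward sweep re-emits everything.
[cite: Shewchuk1997, §2.7 p. 332 (COMPRESS)] -/
theorem compress_eq_of_tieFree (hp : 2 ≤ p) (hfl : IsRoundNearest p emin fl) {e : List ℚ}
    (he : ∀ x ∈ e, IsFloat p emin x) (hexp : IsExpansion 1 e) (htf : CompressTieFree p emin fl e)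
    {em : ℚ} {rest : List ℚ} (hrev : e.reverse = em :: rest) :
    compress fl e = (compressDown fl em rest).2 :: (compressDown fl em rest).1.reverse ∧
      (compress fl e).IsChain (StrictlyAbsorbed p emin) := by
  have hp1 : 1 ≤ p := le_trans (by norm_num) hp
  have he' : e = rest.reverse ++ [em] := by simpa using congrArg List.reverse hrev
  have hcomp : compress fl e =
      compressUp fl (compressDown fl em rest).2 (compressDown fl em rest).1.reverse := by
    simp only [compress, hrev]
  have htf' : DownTieFree p emin fl em rest ∧
      UpTieFree p emin fl (compressDown fl em rest).2 (compressDown fl em rest).1.reverse := by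
    simpa only [CompressTieFree, hrev] using htf
  rw [hcomp]
  subst he'
  have hem : IsFloat p emin em := he em (by simp)
  have hrestF : ∀ y ∈ rest, IsFloat p emin y := fun y hy => he y (by simp [hy])
  have hexp' : IsExpansion 1 rest.reverse := hexp.sublist (List.sublist_append_left _ _)
  have hbel : ∀ y ∈ rest, Below 1 y em := fun y hy =>
    (List.pairwise_append.mp hexp).2.2 y (List.mem_reverse.mpr hy) em (by simp)
  have outd := compressDown_spec hp hfl rest em hem hrestF hexp' hbel
  have hch := compressDown_isChain_of_tieFree hp hfl rest em hem hrestF hexp' hbel htf'.1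
  obtain ⟨-, htfu⟩ := htf'
  generalize hgs : (compressDown fl em rest).1 = gs at *
  generalize hgb : (compressDown fl em rest).2 = gb at *
  have hch' := List.isChain_reverse.mpr hch
  rw [List.reverse_append, List.reverse_singleton, List.singleton_append] at hch'
  obtain ⟨hup, hstrict⟩ := compressUp_eq_cons_of_tieFree hp1 hfl gs.reverse gb outd.hgb
    (fun g hg => outd.floats g (List.mem_reverse.mp hg)) hch' htfu
  rw [hup]
  exact ⟨rfl, hstrict⟩

/-- **COMPRESS off the ties, the output chain**: every component of `COMPRESS(e)` is a nonzero float
lying strictly inside half an ulp of its sum with the next one (`StrictlyAbsorbed`).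
[cite: Shewchuk1997, §2.7 p. 332 (COMPRESS); BoldoEtAl2023, §2.6 Property 2.7] -/
theorem compress_isChain_of_tieFree (hp : 2 ≤ p) (hfl : IsRoundNearest p emin fl) {e : List ℚ}
    (he : ∀ x ∈ e, IsFloat p emin x) (hexp : IsExpansion 1 e) (htf : CompressTieFree p emin fl e) :
    (compress fl e).IsChain (StrictlyAbsorbed p emin) := by
  cases hrev : e.reverse with
  | nil =>
    have he0 : e = [] := by simpa using congrArg List.reverse hrev
    subst he0
    simp [compress]
  | cons em rest => exact (compress_eq_of_tieFree hp hfl he hexp htf hrev).2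

/-- **COMPRESS off the ties is fixed by every round-to-nearest**: if COMPRESS runs tie-free on a
nonoverlapping expansion `e` of floats, then `COMPRESS'(COMPRESS(e)) = COMPRESS(e)` for COMPRESS' run
with ANY round-to-nearest `fl'` (any tie rule). [cite: Shewchuk1997, §2.7 p. 332 (COMPRESS)] -/
theorem compress_compress_of_tieFree (hp : 2 ≤ p) (hfl : IsRoundNearest p emin fl) {e : List ℚ}
    (he : ∀ x ∈ e, IsFloat p emin x) (hexp : IsExpansion 1 e) (htf : CompressTieFree p emin fl e)
    {fl' : ℚ → ℚ} (hfl' : IsRoundNearest p emin fl') :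
    compress fl' (compress fl e) = compress fl e := by
  have hp1 : 1 ≤ p := le_trans (by norm_num) hp
  refine compress_eq_self_of_isChain (fl_zero hfl') ?_
  refine (compress_isChain_of_tieFree hp hfl he hexp htf).imp fun a b h => ?_
  obtain ⟨ha0, ha, hb, hlt⟩ := h
  exact ⟨fl_eq_of_abs_sub_lt_half_ulp hp1 hfl' hb (by rwa [add_sub_cancel_left]),
    fl_eq_self hfl' ha, ha0⟩

/-- **COMPRESS off the ties is idempotent**: `COMPRESS(COMPRESS(e)) = COMPRESS(e)` whenever the first
pass runs tie-free. [cite: Shewchuk1997, §2.7 p. 332 (COMPRESS)] -/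
theorem compress_idempotent_of_tieFree (hp : 2 ≤ p) (hfl : IsRoundNearest p emin fl) {e : List ℚ}
    (he : ∀ x ∈ e, IsFloat p emin x) (hexp : IsExpansion 1 e) (htf : CompressTieFree p emin fl e) :
    compress fl (compress fl e) = compress fl e :=
  compress_compress_of_tieFree hp hfl he hexp htf hfl

/-- **Every extra pass is caused by a tie**: if a second pass of COMPRESS (same rounding) changes the
result, the first pass did not run tie-free. [cite: Shewchuk1997, §2.7 p. 332 (COMPRESS)] -/
theorem not_compressTieFree_of_compress_compress_ne (hp : 2 ≤ p) (hfl : IsRoundNearest p emin fl)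
    {e : List ℚ} (he : ∀ x ∈ e, IsFloat p emin x) (hexp : IsExpansion 1 e)
    (hne : compress fl (compress fl e) ≠ compress fl e) : ¬ CompressTieFree p emin fl e :=
  fun htf => hne (compress_idempotent_of_tieFree hp hfl he hexp htf)

end Summit.Ventures.CertifiedArithmetic.Expansions
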